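import Literature.AlgebraicGeometry.Resolution.BlowupSNC
import Literature.AlgebraicGeometry.Resolution.BlowupChartMembership
import Literature.AlgebraicGeometry.Resolution.MarkedIdealsArithmetic
import Literature.AlgebraicGeometry.Resolution.StalkIdealLemmas
import HarnessLib

/-!
# [OURS · L1 W4.5(b) · EL♮(3)] After blowing up `V(𝓔) ∩ V(𝒦)` the strict transforms of `V(𝓔)` and `V(𝒦)` are DISJOINT: `St 𝓔 ⊔ St 𝒦 = ⊤`
# (tower assembly HSUB′(ReachTower₂)₃ — the old exceptional surface through a cone round)

res-D-pv-029 g8. OURS; NOT a statement of any manuscript; AI-written, weaker than expert review. No `sorry`; standard axioms. DEF-FREE.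
`--supports stmt-ResolutionOfSingularities-20148 --as helper`.

WHAT. `strictTransformIdeal_sup_strictTransformIdeal_eq_top`: `τ : X′ → X` the blow-up of `𝓔 ⊔ 𝒦` with `𝓔`, `𝒦` LOCALLY PRINCIPAL
(`X′` locally Noetherian) ⟹ `strictTransformIdeal τ (𝓔 ⊔ 𝒦) 𝓔 ⊔ strictTransformIdeal τ (𝓔 ⊔ 𝒦) 𝒦 = ⊤`. STALKWISE (Görtz–Wedhorn (13.19),
charts of the blow-up of `(e, κ)`): at `z′` the exceptional stalk `(τ^*e, τ^*κ)` is principal, generated by a non-zero-divisor `ε`; in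
the LOCAL ring `𝒪_{X′,z′}` this forces `(ε) = (τ^*e)` or `(ε) = (τ^*κ)` (`principal_pair_cases`: `ε = x e′ + y κ′`, `e′ = ε a`,
`κ′ = ε b` ⇒ `x a + y b = 1` ⇒ `a` or `b` a unit); in the first case the saturation `St 𝓔 ∋ 1` (`(e′) : (ε) = ⊤`), in the second
`St 𝒦 ∋ 1`. So no point lies in both supports, and an ideal sheaf with empty support is `⊤`.
-/

set_option linter.dupNamespace false -- mandated namespace `Summit.<Summit>.<Problem>` of this single-conjunct summit

noncomputable section

open CategoryTheory AlgebraicGeometry TopologicalSpace IsLocalRing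
open Literature.AlgebraicGeometry.Resolution
open AlgebraicGeometry.Scheme.IdealSheafData

namespace Summit.ResolutionOfSingularities.ResolutionOfSingularities.Cruxes.EquisingularLiftNat.Sections

universe u

/-- Ring lemma: in a local ring, if a non-zero-divisor `ε` generates the ideal `(a, b)`, then `(ε) = (a)` or `(ε) = (b)`. [folklore] -/
theorem principal_pair_cases {R : Type u} [CommRing R] [IsLocalRing R] {ε a b : R} (hε : ε ∈ nonZeroDivisors R)
    (h : Ideal.span {ε} = Ideal.span {a, b}) : Ideal.span {ε} = Ideal.span {a} ∨ Ideal.span {ε} = Ideal.span {b} := by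
  have ha : a ∈ Ideal.span {ε} := h ▸ Ideal.subset_span (by simp)
  have hb : b ∈ Ideal.span {ε} := h ▸ Ideal.subset_span (by simp)
  obtain ⟨a', rfl⟩ := Ideal.mem_span_singleton'.mp ha
  obtain ⟨b', rfl⟩ := Ideal.mem_span_singleton'.mp hb
  have hε' : ε ∈ Ideal.span {a' * ε, b' * ε} := h ▸ Ideal.mem_span_singleton_self ε
  obtain ⟨x, y, hxy⟩ := Ideal.mem_span_pair.mp hε'
  -- `ε (x a' + y b' - 1) = 0`, so `x a' + y b' = 1`
  have h1 : x * a' + y * b' = 1 := by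
    have h0 : (x * a' + y * b' - 1) * ε = 0 := by linear_combination hxy
    have := (mem_nonZeroDivisors_iff.mp hε).2 _ h0
    linear_combination this
  rcases IsLocalRing.isUnit_or_isUnit_of_add_one h1 with hu | hu
  · left
    have ha'u : IsUnit a' := isUnit_of_mul_isUnit_right hu
    rw [Ideal.span_singleton_mul_left_unit ha'u]
  · right
    have hb'u : IsUnit b' := isUnit_of_mul_isUnit_right hu
    rw [Ideal.span_singleton_mul_left_unit hb'u]

/-- If the exceptional stalk `(C·𝒪_{X′})_{z′} = (ε)` equals the pulled-back stalk `(K·𝒪_{X′})_{z′}`, the strict transform of `K` is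
trivial at `z′`: `(St K)_{z′} = ⊤`. [cite: GortzWedhorn2020, (13.19)] -/
theorem stalkIdeal_strictTransformIdeal_eq_top_of_eq {X X' : Scheme.{u}} [IsLocallyNoetherian X'] (τ : X' ⟶ X)
    (C K : X.IdealSheafData) (z' : X')
    (h : (stalkIdeal K (τ z')).map (τ.stalkMap z').hom = stalkIdeal (C.comap τ) z') :
    stalkIdeal (strictTransformIdeal τ C K) z' = ⊤ := by
  rw [stalkIdeal_strictTransformIdeal, eq_top_iff]
  refine le_trans ?_ (le_iSup _ 1)
  intro x _
  rw [h, pow_one, Submodule.mem_colon]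
  intro p hp
  rw [smul_eq_mul, mul_comm]
  exact Ideal.mul_mem_right _ _ hp

/-- **After blowing up `𝓔 ⊔ 𝒦` (both locally principal) the strict transforms of `V(𝓔)` and `V(𝒦)` are disjoint: `St 𝓔 ⊔ St 𝒦 = ⊤`.**
[cite: GortzWedhorn2020, (13.19) and Prop. 13.91] [OURS · L1 W4.5b] -/
theorem strictTransformIdeal_sup_strictTransformIdeal_eq_top {X X' : Scheme.{u}} [IsLocallyNoetherian X'] (τ : X' ⟶ X)
    (𝓔 𝒦 : X.IdealSheafData) (hτ : IsBlowup τ (𝓔 ⊔ 𝒦))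
    (h𝓔p : ∀ z : X, (stalkIdeal 𝓔 z).IsPrincipal) (h𝒦p : ∀ z : X, (stalkIdeal 𝒦 z).IsPrincipal) :
    strictTransformIdeal τ (𝓔 ⊔ 𝒦) 𝓔 ⊔ strictTransformIdeal τ (𝓔 ⊔ 𝒦) 𝒦 = ⊤ := by
  classical
  rw [← Scheme.IdealSheafData.support_eq_bot_iff, eq_bot_iff]
  intro z' hz'
  exfalso
  have hle := (mem_support_iff_stalkIdeal_le _ z').mp hz'
  -- generators
  obtain ⟨e, he⟩ := (h𝓔p (τ z')).principal
  obtain ⟨κ, hκ⟩ := (h𝒦p (τ z')).principal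
  have he' : stalkIdeal 𝓔 (τ z') = Ideal.span {e} := by rw [he, Ideal.submodule_span_eq]
  have hκ' : stalkIdeal 𝒦 (τ z') = Ideal.span {κ} := by rw [hκ, Ideal.submodule_span_eq]
  obtain ⟨ε, hε, hCε⟩ := hτ.isEffectiveCartier.exists_stalkIdeal_eq_span z'
  set φ := (τ.stalkMap z').hom with hφ
  have hC : stalkIdeal ((𝓔 ⊔ 𝒦).comap τ) z' = Ideal.span {φ e, φ κ} := by
    rw [stalkIdeal_comap_eq_map_stalkMap, stalkIdeal_sup, Ideal.map_sup, he', hκ', Ideal.map_span, Ideal.map_span,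
      Set.image_singleton, Set.image_singleton, ← Ideal.span_union, Set.singleton_union]
  rcases principal_pair_cases hε (hCε ▸ hC) with h1 | h1
  · have htop : stalkIdeal (strictTransformIdeal τ (𝓔 ⊔ 𝒦) 𝓔) z' = ⊤ :=
      stalkIdeal_strictTransformIdeal_eq_top_of_eq τ (𝓔 ⊔ 𝒦) 𝓔 z'
        (by rw [he', Ideal.map_span, Set.image_singleton, hCε, h1])
    have : stalkIdeal (strictTransformIdeal τ (𝓔 ⊔ 𝒦) 𝓔 ⊔ strictTransformIdeal τ (𝓔 ⊔ 𝒦) 𝒦) z' = ⊤ := by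
      rw [stalkIdeal_sup, htop, top_sup_eq]
    rw [this] at hle
    exact (maximalIdeal.isMaximal _).ne_top (top_le_iff.mp hle)
  · have htop : stalkIdeal (strictTransformIdeal τ (𝓔 ⊔ 𝒦) 𝒦) z' = ⊤ :=
      stalkIdeal_strictTransformIdeal_eq_top_of_eq τ (𝓔 ⊔ 𝒦) 𝒦 z'
        (by rw [hκ', Ideal.map_span, Set.image_singleton, hCε, h1])
    have : stalkIdeal (strictTransformIdeal τ (𝓔 ⊔ 𝒦) 𝓔 ⊔ strictTransformIdeal τ (𝓔 ⊔ 𝒦) 𝒦) z' = ⊤ := by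
      rw [stalkIdeal_sup, htop, sup_top_eq]
    rw [this] at hle
    exact (maximalIdeal.isMaximal _).ne_top (top_le_iff.mp hle)

end Summit.ResolutionOfSingularities.ResolutionOfSingularities.Cruxes.EquisingularLiftNat.Sections

end
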